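import Mathlib.MeasureTheory.Integral.Average
import Summits.QuantumFields.YangMills.Theorems.BalabanUVNodesN21LevelLedgerMixture
import Literature.MathematicalPhysics.QuantumFieldTheory.Balaban1983to89.T4ShellMeasureFibre

/-!
# YM-DAG node N21 (= NE7c) — THRESHOLD SELECTION: (M1) holds at SOME threshold of every admissible window, for ANY finite family of finite laws
# (lens Card 10), level-by-level selection under older-measurability, and the loss-tolerant slot fields (lens Card 9) — the engine of ROW A″
# «road I at selected thresholds» (`BalabanUVNodesN21SelectedThresholds`, module 18b)

Track A of `YM-PLAN.md` (cell `pub-ymgap`, HUMAN RULING D-0062), node **N21**; R134 fan-out seat `pub-ymgap-dag-n21-d` (s2), generation 4, module 18a.  THEOREMS ONLY: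
0 `def`, 0 `sorry`, standard axioms; COUNT-NEUTRAL; `--supports` the K3′ item `SpineGivenEndpointR12` (stmt-QuantumFields-19908) as a helper.  NO Theses import.
THIS FILE IS the planner seat `ym-lens-BalabanUVNodes-nearmiss` g4's farm-checked sketch `Sketch-nearmiss-g4.lean` (sha16 5a4bf03e3c02b072) §A ∕ §B ∕ §E VERBATIM
(namespace renamed; CREDIT: ym-lens-BalabanUVNodes-nearmiss g4, memo `LENS-nearmiss.md` v4.0 33b38bc0ae91db7d, Cards 8–10, FAN-OUT ROW A″ §1 + ROW L).  Imports module 12a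
`BalabanUVNodesN21LevelLedgerMixture` (p472273: `thresholdMixture_shell_le` via n21-e's `…N21ThresholdMixture`, `mixture_slot_field_two`) and `T4ShellMeasureFibre`
(`slotAntiConcentration_mono`, used by module 18b).

THE POINT.  Road I's only analytic binder is the `LevelLedger.slot` field — (M1)-by-level, `T4ShellMeasure.SlotAntiConcentration` for the law of each tested variable at
its threshold, NOT PRINTED for Bałaban's procedure at its printed thresholds.  §A: for ANY finite family of finite laws SOME threshold of every window `[(1 − κ)θ, θ]`
satisfies it for ALL members at once with `D = #F∕((1 − ρ)κ)` — the window integral of the shell mass is the mixture road's `thresholdMixture_shell_le` (Fubini), and a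
function is somewhere below its average (`MeasureTheory.exists_le_setAverage`); NO hypothesis on the laws.  Level-by-level selection (oldest first) is legitimate as soon
as the level-`m` goodness reads the assignment only through coordinates `≤ m` (`exists_sequential_assignment`).  §B: road I's sharp plug and ROW A′'s mixture plug with
TWO push constants (`M₁` pieces, `M₂` totals; the loss `M₁∕M₂` rides into `D`).  §E: one live level — selection + loss-tolerant sharp plug for a finite slot family.
Discrete ancestor in the tree: `T4ShellMeasure.exists_common_threshold` ∕ `ratio_transfer_of_tilt` (road (δ)'s selection per comparison).

HONEST FRAMING (binding).  [folklore] measure theory; nothing of Bałaban's asserted or instantiated; the thresholds are CHOSEN inside admissible windows (road (δ)'s lever),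
not printed — (M1) for print's FIXED printed thresholds is untouched; NE7c is NOT PRINTED and NOT PROVED; **N21 is NOT discharged**; typed 28∕28, discharged count untouched;
one finite four-torus programme at fixed `ε` — NOT ℝ⁴, NOT infinite volume, NOT OS, NOT a mass gap, NOT Clay.  No decl below carries a cite tag.
-/


set_option autoImplicit false

noncomputable section

open scoped BigOperators ENNReal
open MeasureTheory Set

namespace Summit.QuantumFields.YangMills.Theorems.N21ThresholdSelection

open Literature.MathematicalPhysics.QuantumFieldTheory.Balaban1983to89
open Literature.MathematicalPhysics.QuantumFieldTheory.Balaban1983to89.T4ShellMeasure (SlotAntiConcentration)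
open N21ThresholdMixture (thresholdMixture_shell_le)
open N21LevelLedgerMixture (mixture_slot_field_two)

/-! ## §A (lens g4 §A verbatim) (M1) holds at SOME threshold of every window, for any finite family of laws -/

section Selection

variable {X : Type*} [MeasurableSpace X]

/-- the mass of the moving shell `{s(1 − ρ) ≤ u < s}` is a measurable function of the threshold `s`. [folklore] -/
theorem measurable_shellMass (ν : Measure X) [IsFiniteMeasure ν] {u : X → ℝ} (hu : Measurable u) (ρ : ℝ) :
    Measurable fun s : ℝ => ν {x | s * (1 - ρ) ≤ u x ∧ u x < s} := by
  have hSm : MeasurableSet {p : X × ℝ | p.2 * (1 - ρ) ≤ u p.1 ∧ u p.1 < p.2} :=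
    (measurableSet_le (measurable_snd.mul_const _) (hu.comp measurable_fst)).inter
      (measurableSet_lt (hu.comp measurable_fst) measurable_snd)
  exact measurable_measure_prodMk_right hSm

/-- **THE WINDOW INTEGRAL OF THE SHELL MASS** (the mixture road's Fubini identity, read as a bound on an integral over thresholds):
`∫_{[a, θ]} ν{s(1 − ρ) ≤ u < s} ds ≤ θρ∕(1 − ρ) · ν(univ)`. [folklore] -/
theorem setIntegral_shellMass_le (ν : Measure X) [IsFiniteMeasure ν] {u : X → ℝ} (hu : Measurable u)
    {a θ ρ : ℝ} (hθ : 0 ≤ θ) (hρ0 : 0 ≤ ρ) (hρ1 : ρ < 1) :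
    ∫ s in Icc a θ, (ν {x | s * (1 - ρ) ≤ u x ∧ u x < s}).toReal ≤ θ * ρ / (1 - ρ) * (ν univ).toReal := by
  have h1ρ : 0 < 1 - ρ := by linarith
  set S : Set (X × ℝ) := {p : X × ℝ | p.2 * (1 - ρ) ≤ u p.1 ∧ u p.1 < p.2} with hS
  have hSm : MeasurableSet S :=
    (measurableSet_le (measurable_snd.mul_const _) (hu.comp measurable_fst)).inter
      (measurableSet_lt (hu.comp measurable_fst) measurable_snd)
  have hsec : ∀ s : ℝ, (fun x => (x, s)) ⁻¹' S = {x | s * (1 - ρ) ≤ u x ∧ u x < s} := fun s => rfl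
  have hmeasS : Measurable fun s : ℝ => ν ((fun x => (x, s)) ⁻¹' S) := measurable_measure_prodMk_right hSm
  have key : ∫ s in Icc a θ, (ν ((fun x => (x, s)) ⁻¹' S)).toReal ≤ θ * ρ / (1 - ρ) * (ν univ).toReal := by
    rw [integral_toReal hmeasS.aemeasurable (ae_of_all _ fun s => measure_lt_top _ _),
      ← Measure.prod_apply_symm hSm]
    have h := thresholdMixture_shell_le ν hu (a := a) (θ := θ) hρ0 hρ1
    have h' := ENNReal.toReal_mono (ENNReal.mul_ne_top ENNReal.ofReal_ne_top (measure_ne_top _ _)) h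
    rwa [ENNReal.toReal_mul, ENNReal.toReal_ofReal (by positivity)] at h'
  simpa only [hsec] using key

/-- **SOME THRESHOLD OF THE WINDOW MAKES EVERY SLOT'S NORMALISED SHELL MASS SMALL AT ONCE.**  Finite family `F` of finite laws `ν i` with measurable
tested variables `u i`; window `[(1 − κ)θ, θ]`, `0 < κ ≤ 1`, `θ > 0`; width `0 ≤ ρ < 1`.  THEN some `s` in the window has
`Σ_{i ∈ F} ν_i{s(1 − ρ) ≤ u_i < s} ∕ ν_i(univ) ≤ #F · ρ ∕ ((1 − ρ)κ)`.  (Average of the sum over the window `≤ #F·θρ∕(1−ρ) ∕ (κθ)` by `setIntegral_shellMass_le`;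
a function is somewhere below its average, `MeasureTheory.exists_le_setAverage`.) [folklore] -/
theorem exists_threshold_sum_shellFraction_le {φ : Type*} (F : Finset φ) {Y : φ → Type*}
    [∀ i, MeasurableSpace (Y i)] (ν : ∀ i, Measure (Y i)) [∀ i, IsFiniteMeasure (ν i)]
    {u : ∀ i, Y i → ℝ} (hu : ∀ i, Measurable (u i)) {θ κ ρ : ℝ} (hθ : 0 < θ) (hκ0 : 0 < κ) (hκ1 : κ ≤ 1)
    (hρ0 : 0 ≤ ρ) (hρ1 : ρ < 1) :
    ∃ s ∈ Icc ((1 - κ) * θ) θ,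
      ∑ i ∈ F, ((ν i univ).toReal)⁻¹ * (ν i {x | s * (1 - ρ) ≤ u i x ∧ u i x < s}).toReal
        ≤ F.card * (ρ / ((1 - ρ) * κ)) := by
  have h1ρ : 0 < 1 - ρ := by linarith
  have hκθ : 0 < κ * θ := mul_pos hκ0 hθ
  have _hκ1 := hκ1
  set W : Set ℝ := Icc ((1 - κ) * θ) θ with hW
  have hWvol : volume W = ENNReal.ofReal (κ * θ) := by
    rw [hW, Real.volume_Icc]; congr 1; ring
  have hW0 : volume W ≠ 0 := by rw [hWvol]; exact (ENNReal.ofReal_pos.2 hκθ).ne'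
  have hWtop : volume W ≠ ⊤ := by rw [hWvol]; exact ENNReal.ofReal_ne_top
  -- the summands: measurable, bounded by one, integrable on the window
  have hmeas : ∀ i, Measurable fun s : ℝ => (ν i {x | s * (1 - ρ) ≤ u i x ∧ u i x < s}).toReal := fun i =>
    ENNReal.measurable_toReal.comp (measurable_shellMass (ν i) (hu i) ρ)
  have hnn : ∀ i s, 0 ≤ ((ν i univ).toReal)⁻¹ * (ν i {x | s * (1 - ρ) ≤ u i x ∧ u i x < s}).toReal :=
    fun i s => mul_nonneg (inv_nonneg.2 ENNReal.toReal_nonneg) ENNReal.toReal_nonneg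
  have hbound : ∀ i s, ((ν i univ).toReal)⁻¹ * (ν i {x | s * (1 - ρ) ≤ u i x ∧ u i x < s}).toReal ≤ 1 := by
    intro i s
    have hle : (ν i {x | s * (1 - ρ) ≤ u i x ∧ u i x < s}).toReal ≤ (ν i univ).toReal :=
      ENNReal.toReal_mono (measure_ne_top _ _) (measure_mono (subset_univ _))
    rcases eq_or_lt_of_le (ENNReal.toReal_nonneg : 0 ≤ (ν i univ).toReal) with h0 | hpos
    · rw [← h0, inv_zero, zero_mul]; exact zero_le_one
    · rw [inv_mul_le_iff₀ hpos, mul_one]; exact hle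
  have hint_i : ∀ i ∈ F, IntegrableOn
      (fun s => ((ν i univ).toReal)⁻¹ * (ν i {x | s * (1 - ρ) ≤ u i x ∧ u i x < s}).toReal) W := by
    intro i _
    refine (integrable_const (1 : ℝ)).mono' ((hmeas i).const_mul _).aestronglyMeasurable
      (ae_of_all _ fun s => ?_)
    rw [Real.norm_eq_abs, abs_of_nonneg (hnn i s)]
    exact hbound i s
  have hint : IntegrableOn
      (fun s => ∑ i ∈ F, ((ν i univ).toReal)⁻¹ * (ν i {x | s * (1 - ρ) ≤ u i x ∧ u i x < s}).toReal) W :=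
    integrable_finsetSum F hint_i
  -- the window integral of the sum
  have hI : ∫ s in W, ∑ i ∈ F, ((ν i univ).toReal)⁻¹ * (ν i {x | s * (1 - ρ) ≤ u i x ∧ u i x < s}).toReal
      ≤ F.card * (θ * ρ / (1 - ρ)) := by
    rw [integral_finsetSum F hint_i]
    calc ∑ i ∈ F, ∫ s in W, ((ν i univ).toReal)⁻¹ * (ν i {x | s * (1 - ρ) ≤ u i x ∧ u i x < s}).toReal
        ≤ ∑ _i ∈ F, θ * ρ / (1 - ρ) := Finset.sum_le_sum fun i _ => ?_
      _ = F.card * (θ * ρ / (1 - ρ)) := by rw [Finset.sum_const, nsmul_eq_mul]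
    rw [integral_const_mul]
    have h2 := setIntegral_shellMass_le (ν i) (hu i) (a := (1 - κ) * θ) hθ.le hρ0 hρ1
    rcases eq_or_lt_of_le (ENNReal.toReal_nonneg : 0 ≤ (ν i univ).toReal) with h0 | hpos
    · rw [← h0, inv_zero, zero_mul]; positivity
    · calc ((ν i univ).toReal)⁻¹ * ∫ s in W, (ν i {x | s * (1 - ρ) ≤ u i x ∧ u i x < s}).toReal
          ≤ ((ν i univ).toReal)⁻¹ * (θ * ρ / (1 - ρ) * (ν i univ).toReal) :=
            mul_le_mul_of_nonneg_left h2 (inv_nonneg.2 ENNReal.toReal_nonneg)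
        _ = θ * ρ / (1 - ρ) := by field_simp
  -- a function is somewhere below its average
  obtain ⟨s, hs, hfs⟩ := exists_le_setAverage hW0 hWtop hint
  refine ⟨s, hs, hfs.trans ?_⟩
  rw [setAverage_eq, smul_eq_mul, measureReal_def, hWvol, ENNReal.toReal_ofReal hκθ.le]
  calc (κ * θ)⁻¹ * ∫ a in W, ∑ i ∈ F, ((ν i univ).toReal)⁻¹ * (ν i {x | a * (1 - ρ) ≤ u i x ∧ u i x < a}).toReal
      ≤ (κ * θ)⁻¹ * (F.card * (θ * ρ / (1 - ρ))) := mul_le_mul_of_nonneg_left hI (inv_nonneg.2 hκθ.le)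
    _ = F.card * (ρ / ((1 - ρ) * κ)) := by field_simp

/-- **(M1) IS FREE AT A SELECTABLE THRESHOLD** (lens Card 10, the headline).  For ANY finite family `F` of finite laws with measurable tested variables, SOME
threshold `s` of the admissible window `[(1 − κ)θ, θ]` satisfies the wall statement `SlotAntiConcentration (ν i) (u i) s ρ D` for EVERY `i ∈ F` at once, with
`D = #F ∕ ((1 − ρ)κ)` — no log-concavity, no transversal, no structure of the laws whatsoever.  Road I's original plug `T4ShellMeasure.slot_field_of_antiConcentration`
consumes it verbatim at SHARP carriers.  What is NOT free: the threshold is chosen, not printed ((L1-step) ∕ U2 admissibility of print's single-run bounds over the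
window), and the slot laws `ν i` must not depend on the threshold being chosen (older-measurable dominators, `exists_sequential_assignment`). [folklore] -/
theorem exists_threshold_forall_slotAntiConcentration {φ : Type*} (F : Finset φ) {Y : φ → Type*}
    [∀ i, MeasurableSpace (Y i)] (ν : ∀ i, Measure (Y i)) [∀ i, IsFiniteMeasure (ν i)]
    {u : ∀ i, Y i → ℝ} (hu : ∀ i, Measurable (u i)) {θ κ ρ : ℝ} (hθ : 0 < θ) (hκ0 : 0 < κ) (hκ1 : κ ≤ 1)
    (hρ0 : 0 ≤ ρ) (hρ1 : ρ < 1) :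
    ∃ s ∈ Icc ((1 - κ) * θ) θ, ∀ i ∈ F, SlotAntiConcentration (ν i) (u i) s ρ (F.card / ((1 - ρ) * κ)) := by
  obtain ⟨s, hs, hsum⟩ := exists_threshold_sum_shellFraction_le F ν hu hθ hκ0 hκ1 hρ0 hρ1
  refine ⟨s, hs, fun i hi => ?_⟩
  have h1ρ : 0 < 1 - ρ := by linarith
  have hD : 0 ≤ (F.card : ℝ) / ((1 - ρ) * κ) * ρ := by positivity
  have hterm : ((ν i univ).toReal)⁻¹ * (ν i {x | s * (1 - ρ) ≤ u i x ∧ u i x < s}).toReal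
      ≤ F.card * (ρ / ((1 - ρ) * κ)) :=
    (Finset.single_le_sum (f := fun j => ((ν j univ).toReal)⁻¹ *
        (ν j {x | s * (1 - ρ) ≤ u j x ∧ u j x < s}).toReal)
      (fun j _ => mul_nonneg (inv_nonneg.2 ENNReal.toReal_nonneg) ENNReal.toReal_nonneg) hi).trans hsum
  unfold SlotAntiConcentration
  rcases eq_or_lt_of_le (ENNReal.toReal_nonneg : 0 ≤ (ν i univ).toReal) with h0 | hpos
  · have hu0 : ν i univ = 0 :=
      ((ENNReal.toReal_eq_zero_iff _).1 h0.symm).resolve_right (measure_ne_top _ _)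
    rw [measure_mono_null (subset_univ _) hu0]
    exact zero_le
  · have hreal : (ν i {x | s * (1 - ρ) ≤ u i x ∧ u i x < s}).toReal
        ≤ ((F.card : ℝ) / ((1 - ρ) * κ) * ρ) * (ν i univ).toReal := by
      rw [inv_mul_le_iff₀ hpos] at hterm
      calc (ν i {x | s * (1 - ρ) ≤ u i x ∧ u i x < s}).toReal
          ≤ (ν i univ).toReal * (F.card * (ρ / ((1 - ρ) * κ))) := hterm
        _ = ((F.card : ℝ) / ((1 - ρ) * κ) * ρ) * (ν i univ).toReal := by ring
    calc ν i {x | s * (1 - ρ) ≤ u i x ∧ u i x < s}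
        = ENNReal.ofReal ((ν i {x | s * (1 - ρ) ≤ u i x ∧ u i x < s}).toReal) :=
          (ENNReal.ofReal_toReal (measure_ne_top _ _)).symm
      _ ≤ ENNReal.ofReal (((F.card : ℝ) / ((1 - ρ) * κ) * ρ) * (ν i univ).toReal) :=
          ENNReal.ofReal_le_ofReal hreal
      _ = ENNReal.ofReal ((F.card : ℝ) / ((1 - ρ) * κ) * ρ) * ν i univ := by
          rw [ENNReal.ofReal_mul hD, ENNReal.ofReal_toReal (measure_ne_top _ _)]

/-- **LEVEL-BY-LEVEL SELECTION IS LEGITIMATE UNDER OLDER-MEASURABILITY** (the bookkeeping half of Card 10).  Levels `0, 1, …` ordered OLDEST FIRST; `Good m a` = «the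
threshold `a m` is good for the level-`m` slot family determined by the older coordinates»; `hdep` = `Good m` reads the assignment only through coordinates `≤ m`;
`hstep` = at every level a good threshold exists in the window whatever has been fixed before.  THEN one admissible assignment is good at every level `< n`.  No
compactness, no finite-dependence hypothesis, no cascade count. [folklore] -/
theorem exists_sequential_assignment (W : ℕ → Set ℝ) (Good : ℕ → (ℕ → ℝ) → Prop)
    (hdep : ∀ m a b, (∀ i ≤ m, a i = b i) → Good m a → Good m b)
    (hstep : ∀ m (a : ℕ → ℝ), ∃ s ∈ W m, Good m (Function.update a m s)) (n : ℕ) :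
    ∃ a : ℕ → ℝ, ∀ m < n, a m ∈ W m ∧ Good m a := by
  induction n with
  | zero => exact ⟨fun _ => 0, fun m hm => absurd hm (Nat.not_lt_zero _)⟩
  | succ n ih =>
    obtain ⟨a, ha⟩ := ih
    obtain ⟨s, hs, hgood⟩ := hstep n a
    refine ⟨Function.update a n s, fun m hm => ?_⟩
    rcases Nat.lt_succ_iff_lt_or_eq.1 hm with hlt | rfl
    · have hne : m ≠ n := Nat.ne_of_lt hlt
      refine ⟨?_, ?_⟩
      · simp only [Function.update_apply, if_neg hne]
        exact (ha m hlt).1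
      · refine hdep m a _ (fun i hi => ?_) (ha m hlt).2
        have hin : i ≠ n := Nat.ne_of_lt (lt_of_le_of_lt hi hlt)
        simp only [Function.update_apply, if_neg hin]
    · exact ⟨by rw [Function.update_apply, if_pos rfl]; exact hs, hgood⟩

end Selection

/-! ## §B (lens g4 §B verbatim) Card 9 — loss-tolerant slot fields (two push constants instead of one) -/

section Loss

/-- **ROAD I's SHARP PLUG WITH LOSSES.**  `T4ShellMeasure.slot_field_of_antiConcentration` with the piece push at constant `M₁ ≥ 0` and the total push at constant
`M₂ > 0`: `Σ_τ piece ≤ ((M₁∕M₂)·D·ρ)·Σ_τ A`.  (The landed plug is the case `M₁ = M₂`; print's pushes come with the losses `(1 + W)` fibrewise, `(1 + W₀)` in total mass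
and `e^{2a}` in the source tilt, all `O(1)` and `K`-uniform — they ride into `D`.) [folklore] -/
theorem slot_field_of_antiConcentration_loss {Ω ι : Type*} [MeasurableSpace Ω] {μ : Measure Ω} [IsFiniteMeasure μ]
    {u : Ω → ℝ} {θ ρ D : ℝ} (hD : 0 ≤ D) (hρ : 0 ≤ ρ) (hac : SlotAntiConcentration μ u θ ρ D)
    (T : Finset ι) {piece A : ι → ℝ} {M₁ M₂ : ℝ} (hM₁ : 0 ≤ M₁) (hM₂ : 0 < M₂)
    (hpiece : ∑ τ ∈ T, piece τ ≤ M₁ * (μ {x | θ * (1 - ρ) ≤ u x ∧ u x < θ}).toReal)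
    (hA : M₂ * (μ Set.univ).toReal ≤ ∑ τ ∈ T, A τ) :
    ∑ τ ∈ T, piece τ ≤ ((M₁ / M₂) * D * ρ) * ∑ τ ∈ T, A τ := by
  have hreal : (μ {x | θ * (1 - ρ) ≤ u x ∧ u x < θ}).toReal ≤ D * ρ * (μ Set.univ).toReal := by
    have := ENNReal.toReal_mono (ENNReal.mul_ne_top ENNReal.ofReal_ne_top (measure_ne_top _ _)) hac
    rwa [ENNReal.toReal_mul, ENNReal.toReal_ofReal (by positivity)] at this
  have hM₂' : M₂ ≠ 0 := hM₂.ne'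
  calc ∑ τ ∈ T, piece τ ≤ M₁ * (μ {x | θ * (1 - ρ) ≤ u x ∧ u x < θ}).toReal := hpiece
    _ ≤ M₁ * (D * ρ * (μ Set.univ).toReal) := mul_le_mul_of_nonneg_left hreal hM₁
    _ = ((M₁ / M₂) * D * ρ) * (M₂ * (μ Set.univ).toReal) := by field_simp
    _ ≤ ((M₁ / M₂) * D * ρ) * ∑ τ ∈ T, A τ := mul_le_mul_of_nonneg_left hA (by positivity)

/-- **ROW A′'s PLUG WITH LOSSES** (ROW L rider on module 12a).  `N21LevelLedgerMixture.mixture_slot_field_two` with the sharp piece push at `M₁ ≥ 0` and the sharp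
total push at `M₂ > 0` (both uniform in the threshold over the window): the window-averaged carriers obey the slot field with constant `(M₁∕M₂)·2κ⁻¹`, every `ρ ≥ 0`.
(Rescale the sharp weights by `M₁∕M₂` and cite the landed theorem.) [folklore] -/
theorem mixture_slot_field_two_loss {X ι : Type*} [MeasurableSpace X] {μ : Measure X} [IsFiniteMeasure μ] {u : X → ℝ}
    (hu : Measurable u) {θ ρ κ M₁ M₂ : ℝ} (hθ : 0 < θ) (hρ0 : 0 ≤ ρ) (hκ0 : 0 < κ) (hκ1 : κ < 1)
    (hM₁ : 0 ≤ M₁) (hM₂ : 0 < M₂) (T : Finset ι) {pc Ash : ℝ → ι → ℝ} {piece A : ι → ℝ}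
    (hpc_int : ∀ τ ∈ T, IntegrableOn (fun s => pc s τ) (Icc ((1 - κ) * θ) θ))
    (hA_int : ∀ τ ∈ T, IntegrableOn (fun s => Ash s τ) (Icc ((1 - κ) * θ) θ))
    (hpiece : ∀ s ∈ Icc ((1 - κ) * θ) θ,
      ∑ τ ∈ T, pc s τ ≤ M₁ * (μ {x | s * (1 - ρ) ≤ u x ∧ u x < s}).toReal)
    (hA : ∀ s ∈ Icc ((1 - κ) * θ) θ, M₂ * (μ univ).toReal ≤ ∑ τ ∈ T, Ash s τ)
    (hpieceMix : ∀ τ ∈ T, piece τ = (κ * θ)⁻¹ * ∫ s in Icc ((1 - κ) * θ) θ, pc s τ)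
    (hAMix : ∀ τ ∈ T, A τ = (κ * θ)⁻¹ * ∫ s in Icc ((1 - κ) * θ) θ, Ash s τ) :
    ∑ τ ∈ T, piece τ ≤ ((M₁ / M₂) * (2 * κ⁻¹) * ρ) * ∑ τ ∈ T, A τ := by
  set L : ℝ := M₁ / M₂ with hL
  have hL0 : 0 ≤ L := div_nonneg hM₁ hM₂.le
  have hM₂' : M₂ ≠ 0 := hM₂.ne'
  have hA_int' : ∀ τ ∈ T, IntegrableOn (fun s => L * Ash s τ) (Icc ((1 - κ) * θ) θ) := fun τ hτ =>
    (hA_int τ hτ).const_mul L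
  have hA' : ∀ s ∈ Icc ((1 - κ) * θ) θ, M₁ * (μ univ).toReal ≤ ∑ τ ∈ T, L * Ash s τ := by
    intro s hs
    rw [← Finset.mul_sum]
    calc M₁ * (μ univ).toReal = L * (M₂ * (μ univ).toReal) := by rw [hL]; field_simp
      _ ≤ L * ∑ τ ∈ T, Ash s τ := mul_le_mul_of_nonneg_left (hA s hs) hL0
  have hAMix' : ∀ τ ∈ T, (fun τ => L * A τ) τ = (κ * θ)⁻¹ * ∫ s in Icc ((1 - κ) * θ) θ, L * Ash s τ := by
    intro τ hτ
    show L * A τ = _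
    rw [integral_const_mul, hAMix τ hτ]; ring
  have h := mixture_slot_field_two hu hθ hρ0 hκ0 hκ1 hM₁ T hpc_int hA_int' hpiece hA' hpieceMix hAMix'
  have h' : ∑ τ ∈ T, (fun τ => L * A τ) τ = L * ∑ τ ∈ T, A τ := by simp [Finset.mul_sum]
  rw [h'] at h
  calc ∑ τ ∈ T, piece τ ≤ 2 * κ⁻¹ * ρ * (L * ∑ τ ∈ T, A τ) := h
    _ = (L * (2 * κ⁻¹) * ρ) * ∑ τ ∈ T, A τ := by ring

end Loss

/-! ## §E (lens g4 §E verbatim) One level — selection + loss-tolerant sharp plug, for a finite family of slots -/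

section OneLevel

/-- **THE SELECTED SLOT FIELD** (one live level of one comparison; the selection counterpart of 12a's `mixture_slot_field_two`, for a whole finite family of slots at
once).  Finite family `F` of slots (both runs, every cube ∕ test type of the level), each with its finite DOMINATING LAW `ν i` and measurable tested variable `u i` —
fixed before this level's threshold is chosen; SHARP pieces `pc i s τ` and SHARP weights `Ash i s τ` at every threshold `s` of the admissible window, pushed with losses
`M₁` (pieces) and `M₂ > 0` (totals), uniformly in `s`.  THEN at SOME threshold `s` of the window EVERY slot's sharp pieces obey the slot field
`Σ_τ pc i s τ ≤ ((M₁∕M₂)·(#F∕((1−ρ)κ))·ρ)·Σ_τ Ash i s τ` — at SHARP carriers. [folklore] -/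
theorem selected_slot_field {φ : Type*} (F : Finset φ) {Y : φ → Type*} [∀ i, MeasurableSpace (Y i)]
    (ν : ∀ i, Measure (Y i)) [∀ i, IsFiniteMeasure (ν i)] {u : ∀ i, Y i → ℝ} (hu : ∀ i, Measurable (u i))
    {θ κ ρ M₁ M₂ : ℝ} (hθ : 0 < θ) (hκ0 : 0 < κ) (hκ1 : κ ≤ 1) (hρ0 : 0 ≤ ρ) (hρ1 : ρ < 1)
    (hM₁ : 0 ≤ M₁) (hM₂ : 0 < M₂) {ι : φ → Type*} (T : ∀ i, Finset (ι i)) (pc Ash : ∀ i, ℝ → ι i → ℝ)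
    (hpush : ∀ i ∈ F, ∀ s ∈ Icc ((1 - κ) * θ) θ,
      ∑ τ ∈ T i, pc i s τ ≤ M₁ * (ν i {x | s * (1 - ρ) ≤ u i x ∧ u i x < s}).toReal)
    (htotal : ∀ i ∈ F, ∀ s ∈ Icc ((1 - κ) * θ) θ, M₂ * (ν i univ).toReal ≤ ∑ τ ∈ T i, Ash i s τ) :
    ∃ s ∈ Icc ((1 - κ) * θ) θ, ∀ i ∈ F,
      ∑ τ ∈ T i, pc i s τ ≤ ((M₁ / M₂) * (F.card / ((1 - ρ) * κ)) * ρ) * ∑ τ ∈ T i, Ash i s τ := by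
  obtain ⟨s, hs, hac⟩ := exists_threshold_forall_slotAntiConcentration F ν hu hθ hκ0 hκ1 hρ0 hρ1
  refine ⟨s, hs, fun i hi => ?_⟩
  have h1ρ : 0 < 1 - ρ := by linarith
  exact slot_field_of_antiConcentration_loss (by positivity) hρ0 (hac i hi) (T i) hM₁ hM₂
    (hpush i hi s hs) (htotal i hi s hs)

end OneLevel

end Summit.QuantumFields.YangMills.Theorems.N21ThresholdSelection

end
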